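import Summits.BirchSwinnertonDyer.BirchSwinnertonDyer.Theorems.AlignedTransportAtTwoMainConjectureOfRankZeroBSDAtTwoHalfDescentDefect
import Summits.BirchSwinnertonDyer.Rank1Residual.X5.TwoAdicMuZeroUpgrade
import HarnessLib

/-!
# Route `AlignedTransportAtTwo`, crux C2 `MainConjectureOfRankZeroBSDAtTwo` (stmt-BirchSwinnertonDyer-22298):
# KATO IN HALF-DEGREE COORDINATES, IV — AT THE DATUM: Kato's Thm. 17.4 (1)(2) at `2` reads **`h_X ∣ h_an` in `ℤ₂[Y]`**, `k_X ≤ k_an`,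
# `h_an = h_X · r` with `r ≡ Y^d (mod 2)`; on a weight-certified datum `μ(X) ≥ μ_an` with equality iff `(k, h)_X = (k, h)_an`, and then `char X = (G)`

HONEST FRAMING (cell `bsd-f1-sign2`, WIDTH-5 attached prover seat `bsd-line-att-p5` gen 52 on line `birth` of the lead `bsd-line-att-p2`;
`--supports` stmt-BirchSwinnertonDyer-22298, closes nothing; BSD is NOT proved by any of this; the crux C2, its verdict «blocked-on
`Rank1Residual.GreenbergMuConjectureIrreducible`» and every registered stub (P / T / Kμ / LimDoor / MuIneqʳ / PFμ⁺) are untouched). THEOREMS ONLY —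
no `def`, no instance, no named fact, no `sorry`; the ONE print binder is `h17 : kato_divisibility_allPrimes W 2` (Kato 2004 Thm. 17.4 (1)(2) at `2`
for the newform `f`, the tree's named fact, displayed as a hypothesis exactly as in the lineage's `…LambdaSeed` / `…LayerValueDoublyDarkKato`).
The normal forms `P = (T+2)^k·𝒯'_m(h)` of the generator `f_X` of `char_Λ X(W/ℚ_∞)` and of an integral lift `G` of `L₂(f, α)` are DISPLAYED
hypotheses (supplied by g51's `…HalfDescentTwistZeroValues.exists_twistZero_realCounterpart_charGen` (mod Greenberg 1.14) and
`…HalfDescentAnalytic.exists_twistZero_realCounterpart_evenBranchLift` (binder-free)); so is the weight certificate `ord₂ f_X(0) = ord₂ G(0)`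
(Greenberg's Thm. 4.1 + the BSD₂ formula in rank `0`, the lineage's seed currency). Pure wiring of `…HalfDescentKato` / `…HalfDescentDefect`
onto the tree's `O1.MuZeroUpgrade.exists_mul_charGen_eq_of_kato_allPrimes` (Kato pulled back to `Λ`).
* §1 `isTorsion_and_charGen_dvd_C_pow_mul_lift`: PRINT `h17` ⟹ `X` torsion and **`f_X ∣ 2^n · G`** for every integral lift `G` of `L₂(f, α)`.
* §2 ★★★ `realCounterpart_charGen_dvd_of_kato` (**`h_X ∣ h_an`**, `k_X ≤ k_an`, the defect `r`); ★★★ `mu_charGen_eq_iff_of_kato_of_weightCertified`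
  (weight-certified: `μ(G) ≤ μ(f_X)`; `μ(f_X) = μ(G) ⟺ (k, h)_X = (k, h)_an`; and then **`char X = (G)`** at the datum).
Memo `Cruxes/MainConjectureOfRankZeroBSDAtTwo/KATO-COORDINATES-att-p5-g52.md`. BSD is not proved by any of this; no particular curve is certified here.

References: K. Kato, Astérisque 295 (2004), Thm. 17.4 (1)(2) [Kato2004Asterisque]; R. Greenberg, LNM 1716 (1999), Thm. 4.1, p. 180 [GreenbergLNM1716];
R. Greenberg, V. Vatsal, Invent. Math. 142 (2000) p. 4 [GreenbergVatsal2000].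
-/

set_option linter.dupNamespace false
set_option autoImplicit false

noncomputable section

open scoped Classical MatrixGroups ModularForm

namespace Summit.BirchSwinnertonDyer.BirchSwinnertonDyer.Theorems.AlignedTransportAtTwoHalfDescentKatoAtTwo

open PowerSeries CongruenceSubgroup WeierstrassCurve Literature.NumberTheory.EllipticCurves
  Literature.NumberTheory.EllipticCurves.IwasawaAlgebra
  Literature.NumberTheory.EllipticCurves.ModularForms
  Literature.NumberTheory.EllipticCurves.Rank1Residual
  Summit.BirchSwinnertonDyer.Rank1Residual
  Summit.BirchSwinnertonDyer.Rank1Residual.X1.MuLambda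
  Summit.BirchSwinnertonDyer.Rank1Residual.X5
  Summit.BirchSwinnertonDyer.BirchSwinnertonDyer.Theorems.AlignedTransportAtTwoHalfDescentDivisibility
  Summit.BirchSwinnertonDyer.BirchSwinnertonDyer.Theorems.AlignedTransportAtTwoHalfDescentKato
  Summit.BirchSwinnertonDyer.BirchSwinnertonDyer.Theorems.AlignedTransportAtTwoHalfDescentDefect

variable (W : WeierstrassCurve ℚ) [W.IsGloballyMinimal]

/-! ## §1 Kato's divisibility at `2` as `f_X ∣ 2^n · G` in `Λ` -/

/-- **Kato at `2`, pulled back to `Λ`: `f_X ∣ 2^n·G`.** `W/ℚ` globally minimal, ordinary at `2`, `f` a newform of `W` with an INTEGRAL lift `G` of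
`L₂(f, α)` (`ι G = L₂(f, α)`); PRINT `h17` = Kato's Thm. 17.4 (1)(2) at `2` for `f`. Then for every cyclotomic dual datum `D` with `char X = (f_X)`:
`X` is `Λ`-torsion and **`f_X ∣ 2^n · G` for some `n`** (`2 = ((2 : ℕ) : ℤ₂)`, the shape of the any-`p` lemmas) (the tree's `O1.MuZeroUpgrade.exists_mul_charGen_eq_of_kato_allPrimes` at `ϖ = 1`).
[cite: Kato2004Asterisque, Thm. 17.4 (1)(2) (p. 273)] -/
theorem isTorsion_and_charGen_dvd_C_pow_mul_lift {N : ℕ} [NeZero N] {f : CuspForm (Gamma0 N) 2} (h17 : kato_divisibility_allPrimes W 2 (f := f))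
    {κ : ZpExtension ℚ 2} {γ : Field.absoluteGaloisGroup ℚ} (hκ : κ.IsCyclotomic) (hγ : κ.IsTopGenerator γ) (hγ' : IsCyclotomicVariable 2 γ)
    (hord : IsOrdinaryAt W 2) (hf : IsNewformOf W f) (D : W.SelmerDualData κ γ) {fX : IwasawaAlgebra 2}
    (hchar : D.charIdeal = Ideal.span {fX}) {G : IwasawaAlgebra 2}
    (hG : iwasawaToPowerSeries 2 G = padicLFunction f (unitRoot W 2 : ℚ_[2])) :
    D.IsTorsion ∧ ∃ n : ℕ, fX ∣ PowerSeries.C (((2 : ℕ) : ℤ_[2]) ^ n) * G := by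
  have hG' : iwasawaToPowerSeries 2 G = PowerSeries.C ((1 : ℚ) : ℚ_[2]) * padicLFunction f (unitRoot W 2 : ℚ_[2]) := by
    rw [Rat.cast_one, map_one, one_mul]; exact hG
  obtain ⟨hD, a, n, hkey⟩ := O1.MuZeroUpgrade.exists_mul_charGen_eq_of_kato_allPrimes W 2 h17 hκ hγ hγ' hord hf D hchar hG'
  refine ⟨hD, n, a, ?_⟩
  rw [Rat.num_one, Rat.den_one, Int.cast_one, Nat.cast_one, map_one, one_mul, one_mul] at hkey
  rw [← hkey, mul_comm]

/-! ## §2 The real counterpart of `char X` divides the analytic real counterpart -/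

/-- ★★★ **KATO IN HALF-DEGREE COORDINATES AT THE DATUM.** `W/ℚ` globally minimal, ordinary at `2`; `f` a newform of `W`, `G ≠ 0` an integral lift
of `L₂(f, α)`; PRINT `h17` (Kato 17.4 (1)(2) at `2` for `f`). At a cyclotomic dual datum with `char X = (f_X)`, `f_X ≠ 0`, let
`P_X = (T+2)^{k₁}·(1+T)^{m₁}·h₁(γ+γ⁻¹)` be the normal form of the distinguished polynomial of (the `2`-free part of) `f_X` with `k₁ = ord_{−2}P_X`
(g51: `…exists_twistZero_realCounterpart_charGen`, mod Greenberg 1.14) and `P_G = (T+2)^{k₂}·(1+T)^{m₂}·h₂(γ+γ⁻¹)` that of `G` (g51: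
`…exists_twistZero_realCounterpart_evenBranchLift`, binder-free). Then **`h₁ ∣ h₂` in `ℤ₂[Y]`**, `k₁ ≤ k₂` when `k₂ = ord_{−2}P_G`, and
**`h₂ = h₁·r`** with `r` monic of degree `m₂ − m₁`, **`r ≡ Y^{m₂−m₁} (mod 2)`**: the analytic real counterpart is the algebraic one times a
distinguished DEFECT POLYNOMIAL. [cite: Kato2004Asterisque, Thm. 17.4 (1)(2) (p. 273)] [cite: GreenbergVatsal2000, p. 4] -/
theorem realCounterpart_charGen_dvd_of_kato {N : ℕ} [NeZero N] {f : CuspForm (Gamma0 N) 2} (h17 : kato_divisibility_allPrimes W 2 (f := f))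
    {κ : ZpExtension ℚ 2} {γ : Field.absoluteGaloisGroup ℚ} (hκ : κ.IsCyclotomic) (hγ : κ.IsTopGenerator γ) (hγ' : IsCyclotomicVariable 2 γ)
    (hord : IsOrdinaryAt W 2) (hf : IsNewformOf W f) (D : W.SelmerDualData κ γ) {fX : IwasawaAlgebra 2} (hfX : fX ≠ 0)
    (hchar : D.charIdeal = Ideal.span {fX}) {G : IwasawaAlgebra 2} (hG0 : G ≠ 0)
    (hG : iwasawaToPowerSeries 2 G = padicLFunction f (unitRoot W 2 : ℚ_[2])) {k₁ m₁ k₂ m₂ : ℕ} {h₁ h₂ : Polynomial ℤ_[2]}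
    (hm₁ : h₁.Monic) (hd₁ : h₁.natDegree = m₁) (hm₂ : h₂.Monic) (hd₂ : h₂.natDegree = m₂)
    (hk₁ : k₁ = ((pfree fX).weierstrassDistinguished (red_pfree_ne_zero hfX)).rootMultiplicity (-2))
    (hP₁ : (pfree fX).weierstrassDistinguished (red_pfree_ne_zero hfX) = (Polynomial.X + Polynomial.C 2) ^ k₁ *
      ∑ j ∈ Finset.range (m₁ + 1), Polynomial.C (h₁.coeff j) * (Polynomial.X + Polynomial.C 1) ^ (m₁ - j) *
        ((Polynomial.X + Polynomial.C 1) ^ 2 + Polynomial.C 1) ^ j)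
    (hP₂ : (pfree G).weierstrassDistinguished (red_pfree_ne_zero hG0) = (Polynomial.X + Polynomial.C 2) ^ k₂ *
      ∑ j ∈ Finset.range (m₂ + 1), Polynomial.C (h₂.coeff j) * (Polynomial.X + Polynomial.C 1) ^ (m₂ - j) *
        ((Polynomial.X + Polynomial.C 1) ^ 2 + Polynomial.C 1) ^ j) :
    h₁ ∣ h₂ ∧ (k₂ = ((pfree G).weierstrassDistinguished (red_pfree_ne_zero hG0)).rootMultiplicity (-2) → k₁ ≤ k₂) ∧
      ∃ r : Polynomial ℤ_[2], h₂ = h₁ * r ∧ r.Monic ∧ r.natDegree = m₂ - m₁ ∧ m₁ ≤ m₂ ∧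
        r.map (IsLocalRing.residue ℤ_[2]) = Polynomial.X ^ (m₂ - m₁) := by
  obtain ⟨-, n, hdvd⟩ := isTorsion_and_charGen_dvd_C_pow_mul_lift W h17 hκ hγ hγ' hord hf D hchar hG
  obtain ⟨hdiv, -, hk⟩ := realCounterpart_dvd_of_dvd_C_pow_mul hfX hG0 hdvd hm₁ hd₁ hm₂ hd₂ hk₁ hP₁ hP₂
  obtain ⟨r, hr, hrm, hrd, hle, hrmap⟩ := exists_defect_of_dvd_C_pow_mul hfX hG0 hdvd hm₁ hd₁ hm₂ hd₂ hk₁ hP₁ hP₂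
  refine ⟨hdiv, hk, r, hr, hrm, hrd, hle, ?_⟩
  rw [hrmap]
  have h2 : (Polynomial.C (2 : IsLocalRing.ResidueField ℤ_[2])) = 0 := by
    have h20 : (2 : IsLocalRing.ResidueField ℤ_[2]) = 0 := by
      have := (IsLocalRing.residue_eq_zero_iff (2 : ℤ_[2])).mpr
        (by rw [PadicInt.maximalIdeal_eq_span_p, Ideal.mem_span_singleton, Nat.cast_ofNat])
      rwa [map_ofNat] at this
    rw [h20, map_zero]
  rw [h2, sub_zero]

/-- ★★★ **WEIGHT-CERTIFIED DATUM: `μ(f_X) ≥ μ(G)`, WITH EQUALITY IFF `(k, h)_X = (k, h)_an`, AND THEN `char X = (G)`.** Same setting, both normal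
forms normalised (`k₂ = ord_{−2}P_G`), `f_X(0) ≠ 0 ≠ G(0)`, and the WEIGHT CERTIFICATE `ord₂ f_X(0) = ord₂ G(0)` (displayed; on the seed cell it is
Greenberg's Thm. 4.1 + the BSD₂ formula in rank `0`). Then `μ(G) ≤ μ(f_X)`; **`μ(f_X) = μ(G) ⟺ (k₁ = k₂ ∧ h₁ = h₂)`**; and if `μ(f_X) = μ(G)` then
**`char_Λ X = (G)`** at this datum — Mazur's main conjecture at `2` for `(W, D)` with the lift `G`. Equivalently
`μ(f_X) − μ(G) = (k₂ − k₁) + ord₂ r(2)`: Greenberg's `μ = 0` at `2` (with `μ(G) = 0`) is EXACTLY «no excess analytic twist zero and no defect».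
[cite: Kato2004Asterisque, Thm. 17.4 (1)(2) (p. 273)] [cite: GreenbergLNM1716, Thm. 4.1 (p. 102) and p. 180] [cite: GreenbergVatsal2000, p. 4 (after Thm. (1.2))] -/
theorem mu_charGen_eq_iff_of_kato_of_weightCertified {N : ℕ} [NeZero N] {f : CuspForm (Gamma0 N) 2}
    (h17 : kato_divisibility_allPrimes W 2 (f := f)) {κ : ZpExtension ℚ 2} {γ : Field.absoluteGaloisGroup ℚ} (hκ : κ.IsCyclotomic)
    (hγ : κ.IsTopGenerator γ) (hγ' : IsCyclotomicVariable 2 γ) (hord : IsOrdinaryAt W 2) (hf : IsNewformOf W f) (D : W.SelmerDualData κ γ)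
    {fX : IwasawaAlgebra 2} (hfX : fX ≠ 0) (hchar : D.charIdeal = Ideal.span {fX}) {G : IwasawaAlgebra 2} (hG0 : G ≠ 0)
    (hG : iwasawaToPowerSeries 2 G = padicLFunction f (unitRoot W 2 : ℚ_[2])) (hfX0 : constantCoeff fX ≠ 0) (hGc : constantCoeff G ≠ 0)
    (hw : (constantCoeff fX).valuation = (constantCoeff G).valuation) {k₁ m₁ k₂ m₂ : ℕ} {h₁ h₂ : Polynomial ℤ_[2]}
    (hm₁ : h₁.Monic) (hd₁ : h₁.natDegree = m₁) (hm₂ : h₂.Monic) (hd₂ : h₂.natDegree = m₂)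
    (hk₁ : k₁ = ((pfree fX).weierstrassDistinguished (red_pfree_ne_zero hfX)).rootMultiplicity (-2))
    (hk₂ : k₂ = ((pfree G).weierstrassDistinguished (red_pfree_ne_zero hG0)).rootMultiplicity (-2))
    (hP₁ : (pfree fX).weierstrassDistinguished (red_pfree_ne_zero hfX) = (Polynomial.X + Polynomial.C 2) ^ k₁ *
      ∑ j ∈ Finset.range (m₁ + 1), Polynomial.C (h₁.coeff j) * (Polynomial.X + Polynomial.C 1) ^ (m₁ - j) *
        ((Polynomial.X + Polynomial.C 1) ^ 2 + Polynomial.C 1) ^ j)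
    (hP₂ : (pfree G).weierstrassDistinguished (red_pfree_ne_zero hG0) = (Polynomial.X + Polynomial.C 2) ^ k₂ *
      ∑ j ∈ Finset.range (m₂ + 1), Polynomial.C (h₂.coeff j) * (Polynomial.X + Polynomial.C 1) ^ (m₂ - j) *
        ((Polynomial.X + Polynomial.C 1) ^ 2 + Polynomial.C 1) ^ j) :
    mu G ≤ mu fX ∧ (mu fX = mu G ↔ k₁ = k₂ ∧ h₁ = h₂) ∧ (mu fX = mu G → D.charIdeal = Ideal.span {G}) := by
  obtain ⟨-, n, hdvd⟩ := isTorsion_and_charGen_dvd_C_pow_mul_lift W h17 hκ hγ hγ' hord hf D hchar hG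
  obtain ⟨hμ, hiff, -, hspan⟩ :=
    mu_le_and_mu_eq_iff_of_weightCertified hfX hG0 hfX0 hGc hdvd hw hm₁ hd₁ hm₂ hd₂ hk₁ hk₂ hP₁ hP₂
  exact ⟨hμ, hiff, fun h ↦ hchar.trans (hspan h)⟩

end Summit.BirchSwinnertonDyer.BirchSwinnertonDyer.Theorems.AlignedTransportAtTwoHalfDescentKatoAtTwo

end
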